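import Summits.AtomisticToContinuum.Crystallization.Theorems.PhononStability.Negative.Mirror

/-!
# `PhononStability` (stmt-AtomisticToContinuum-9333), line `contragredient-window-collapse`: vocabulary

Route `ExcessDecayLiouville`, crux `PhononStability` (uniform harmonic stability of Lennard-Jones over the
admissible affine-hcp window, `κ·nnForm ≤ hessForm/2`, mirror `Theorems/PhononStability/Negative/Mirror.lean`).
This file fixes the VOCABULARY of the line `contragredient-window-collapse` (crux workfile
`Cruxes/PhononStability/Lines/contragredient_window_collapse.lean`) so that the line's stub lemmas, landed as
separate `--supports` files, speak about the same objects: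

* labels `Label = Fin 2 × ℤ³`, ordered bond classes `BondClass = Fin 2 × Fin 2 × ℤ³`, the reference hcp
  two-lattice (`genU genV genC innerRef latVec refPos bondVec bondDiff siteMap`);
* the pulled-back coefficients `omegaLJ ψ = psiLJ` (`Hess(Aζ)(BΔ) = ω(‖Aζ‖)⟪ζ,Δ⟫² + ψ(‖Aζ‖)‖BΔ‖²` for
  `B = A⁻ᵀ`), the class functionals `longForm metricForm plainForm`, the class term `classTerm`, the pulled-back
  forms `Hform Nform Fform`, the truncated-with-tail form `GR`;
* the window in pulled-back coordinates `CellWindow ShiftWindow Contragredient MetricBand ExtWindow`, the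
  nearest-neighbour classes `nnClasses`, the finite ranges `classBox classesR`, the tail functional
  `farCoeff tailForm`, the lattice-sum summability predicate `LatticeSummable`;
* the line's CERTIFICATE FORMAT (`Vertex PhiR Cover Coercive VertexCertificate`: finitely many fixed-coefficient
  reference operators, a cover of the dilation-extreme sheet by dominated data, per-vertex coercivity) and the
  seven STUB STATEMENTS registered on the crux item (`LatticeSum LabelModel PullbackReduction WindowGeometry
  TailControl DilationReduction VertexCertificate`), each to be proved by a `--supports` file of the line as
  `theorem stub_<name> : <Statement>`; the sorry-free composition to the crux lives in the crux workfile and lands last.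

These are line-internal bookkeeping definitions and proof obligations of THIS line (targets, not literature facts and
not assumptions of any landed theorem); everything is `[folklore]`; nothing here closes an item.  Elementary proved
API over this vocabulary is in `Theorems/ExcessDecayLiouvillePhononStabilityBasics.lean`.
-/

noncomputable section

open scoped BigOperators Classical InnerProductSpace
open Filter Set Function
open Literature.MathematicalPhysics.StatisticalMechanics
open Summit.AtomisticToContinuum.Crystallization.Theses.ExcessDecayLiouville
open Summit.AtomisticToContinuum.Crystallization.Theorems.PhononStabilityNegative

namespace Summit.AtomisticToContinuum.Crystallization.Theorems.PhononStabilityCWC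

local notation "E3" => EuclideanSpace ℝ (Fin 3)

/-! ## Labels, classes, the reference two-lattice -/

/-- Labels `(m, n)`: sublattice `m ∈ {0,1}`, lattice coordinates `n ∈ ℤ³`. [folklore] -/
abbrev Label := Fin 2 × (Fin 3 → ℤ)

/-- Ordered bond classes `(m, m', n)`: the bond from label `(m, k)` to label `(m', k + n)` (any `k`). [folklore] -/
abbrev BondClass := Fin 2 × Fin 2 × (Fin 3 → ℤ)

/-- First generator `u = (1,0,0)` of the crux's period lattice `Λ = ℤu + ℤv + ℤ·2√(2/3)e₃` (`Λ₀` of the mirror). [folklore] -/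
def genU : E3 := triangularVec₁ 1
/-- Second generator `v = (1/2, √3/2, 0)`. [folklore] -/
def genV : E3 := triangularVec₂ 1
/-- Third generator `2√(2/3)·e₃`. [folklore] -/
def genC : E3 := layerNormal (2 * Real.sqrt (2 / 3))
/-- The reference inner displacement `w + √(2/3)e₃ = u/3 + v/3 + genC/2` of the crux's `Inner` predicate. [folklore] -/
def innerRef : E3 := barlowOffset 1 + layerNormal (Real.sqrt (2 / 3))

/-- The lattice vector with integer coordinates `n`. [folklore] -/
def latVec (n : Fin 3 → ℤ) : E3 := (n 0 : ℝ) • genU + (n 1 : ℝ) • genV + (n 2 : ℝ) • genC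

/-- Pulled-back reference position of label `(m, n)` when the pulled-back inner shift is `innerRef + δ`:
the actual site is `t 0 + A (refPos δ (m, n))`. [folklore] -/
def refPos (δ : E3) (ℓ : Label) : E3 := latVec ℓ.2 + if ℓ.1 = 1 then innerRef + δ else 0

/-- The label-to-site map of the datum `(t, A)` with pulled-back shift error `δ`. [folklore] -/
def siteMap (t : Fin 2 → E3) (A : E3 →L[ℝ] E3) (δ : E3) (ℓ : Label) : E3 := t 0 + A (refPos δ ℓ)

/-- Pulled-back bond vector of class `c = (m, m', n)` (independent of the base label). [folklore] -/
def bondVec (δ : E3) (c : BondClass) : E3 := refPos δ (c.2.1, c.2.2) - refPos δ (c.1, 0)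

/-- Displacement difference across the bond of class `c` based at `k`. [folklore] -/
def bondDiff (c : BondClass) (w : Label → E3) (k : Fin 3 → ℤ) : E3 := w (c.2.1, k + c.2.2) - w (c.1, k)

/-! ## Pulled-back coefficients and forms -/

/-- `ω(r) = (V″ − V′/r)/r² = 14 r⁻¹⁶ − 8 r⁻¹⁰` (longitudinal pulled-back LJ coefficient). [folklore] -/
def omegaLJ (r : ℝ) : ℝ := 14 * (r⁻¹) ^ 16 - 8 * (r⁻¹) ^ 10
/-- `ψ(r) = V′(r)/r = −r⁻¹⁴ + r⁻⁸` (transverse / pre-stress coefficient). [folklore] -/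
def psiLJ (r : ℝ) : ℝ := -(r⁻¹) ^ 14 + (r⁻¹) ^ 8

/-- Longitudinal class functional `X_c(δ, w) = Σ_k ⟪ζ_c(δ), Δ_c w k⟫²` (direction exact, metric-free). [folklore] -/
def longForm (δ : E3) (c : BondClass) (w : Label → E3) : ℝ :=
  ∑' k, (inner ℝ (bondVec δ c) (bondDiff c w k)) ^ 2
/-- Metric class functional `Y_c(B, w) = Σ_k ‖B(Δ_c w k)‖²` (`B = A⁻ᵀ`). [folklore] -/
def metricForm (B : E3 →L[ℝ] E3) (c : BondClass) (w : Label → E3) : ℝ :=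
  ∑' k, ‖B (bondDiff c w k)‖ ^ 2
/-- Metric-free class functional `Σ_k ‖Δ_c w k‖²`. [folklore] -/
def plainForm (c : BondClass) (w : Label → E3) : ℝ :=
  ∑' k, ‖bondDiff c w k‖ ^ 2

/-- The class term of the pulled-back second variation: `ω(‖Aζ_c‖)·X_c + ψ(‖Aζ_c‖)·Y_c`
(for the diagonal class `(m, m, 0)` everything vanishes). [folklore] -/
def classTerm (A B : E3 →L[ℝ] E3) (δ : E3) (w : Label → E3) (c : BondClass) : ℝ :=
  omegaLJ ‖A (bondVec δ c)‖ * longForm δ c w + psiLJ ‖A (bondVec δ c)‖ * metricForm B c w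

/-- Pulled-back second variation (ordered pairs, not halved): the target of `hessForm = Hform`. [folklore] -/
def Hform (A B : E3 →L[ℝ] E3) (δ : E3) (w : Label → E3) : ℝ :=
  ∑' c, classTerm A B δ w c

/-- Pulled-back nearest-neighbour form with the crux's metric cut-off `‖Aζ‖ ≤ 11/10`: target of `nnForm = Nform`. [folklore] -/
def Nform (A B : E3 →L[ℝ] E3) (δ : E3) (w : Label → E3) : ℝ :=
  ∑' c : BondClass, if ‖A (bondVec δ c)‖ ≤ 11 / 10 then metricForm B c w else 0

/-- `Hform − 2κ·Nform`: the crux reads `0 ≤ Fform κ A B δ w` (then halve). [folklore] -/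
def Fform (κ : ℝ) (A B : E3 →L[ℝ] E3) (δ : E3) (w : Label → E3) : ℝ :=
  Hform A B δ w - 2 * κ * Nform A B δ w

/-! ## The window in pulled-back coordinates -/

/-- Admissible cells have all stretches in `[0.945, 0.995]` (from `‖A − 0.97R‖ ≤ 1/40`). [folklore] -/
def CellWindow (A : E3 →L[ℝ] E3) : Prop :=
  ∀ x : E3, 189 / 200 * ‖x‖ ≤ ‖A x‖ ∧ ‖A x‖ ≤ 199 / 200 * ‖x‖

/-- The pulled-back inner-shift error: `t 1 − t 0 = A (innerRef + δ)` with `‖Aδ‖ ≤ 1/40`. [folklore] -/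
def ShiftWindow (A : E3 →L[ℝ] E3) (δ : E3) : Prop := ‖A δ‖ ≤ 1 / 40

/-- `B = A⁻ᵀ`, stated without inverses: `⟪Ax, By⟫ = ⟪x, y⟫`. [folklore] -/
def Contragredient (A B : E3 →L[ℝ] E3) : Prop := ∀ x y : E3, inner ℝ (A x) (B y) = inner ℝ x y

/-- The Gram band of `B = A⁻ᵀ` over the window: stretches of `B` in `[200/199, 200/189]`. [folklore] -/
def MetricBand (B : E3 →L[ℝ] E3) : Prop :=
  ∀ x : E3, 200 / 199 * ‖x‖ ≤ ‖B x‖ ∧ ‖B x‖ ≤ 200 / 189 * ‖x‖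

/-- The DILATION-EXTREME sheet of the window: some principal stretch at an end of `[0.945, 0.995]`, or the
shift at its maximal size. [folklore] -/
def ExtWindow (A : E3 →L[ℝ] E3) (δ : E3) : Prop :=
  CellWindow A ∧ ShiftWindow A δ ∧
    ((∃ x : E3, x ≠ 0 ∧ ‖A x‖ = 189 / 200 * ‖x‖) ∨ (∃ x : E3, x ≠ 0 ∧ ‖A x‖ = 199 / 200 * ‖x‖) ∨
      ‖A δ‖ = 1 / 40)

/-- The diagonal (zero) class `(m, m, 0)`. [folklore] -/
def diagClass (c : BondClass) : Prop := c.1 = c.2.1 ∧ c.2.2 = 0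

/-- The 24 ordered nearest-neighbour classes of the hcp two-lattice (6 in-plane per sublattice; 3 up + 3 down
inter-sublattice bonds from each sublattice), in the coordinates of `latVec` / `innerRef`. [folklore] -/
def nnClasses : Finset BondClass :=
  {((0 : Fin 2), (0 : Fin 2), (![1, 0, 0] : Fin 3 → ℤ)), (0, 0, ![-1, 0, 0]), (0, 0, ![0, 1, 0]),
    (0, 0, ![0, -1, 0]), (0, 0, ![1, -1, 0]), (0, 0, ![-1, 1, 0]),
    (1, 1, ![1, 0, 0]), (1, 1, ![-1, 0, 0]), (1, 1, ![0, 1, 0]),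
    (1, 1, ![0, -1, 0]), (1, 1, ![1, -1, 0]), (1, 1, ![-1, 1, 0]),
    (0, 1, ![0, 0, 0]), (0, 1, ![-1, 0, 0]), (0, 1, ![0, -1, 0]),
    (0, 1, ![0, 0, -1]), (0, 1, ![-1, 0, -1]), (0, 1, ![0, -1, -1]),
    (1, 0, ![0, 0, 0]), (1, 0, ![1, 0, 0]), (1, 0, ![0, 1, 0]),
    (1, 0, ![0, 0, 1]), (1, 0, ![1, 0, 1]), (1, 0, ![0, 1, 1])}

/-- A finite box of classes containing every class of reference length `≤ R`
(`‖ζ⁰‖ ≤ R ⇒ |nᵢ| ≤ 2R + 1`). [folklore] -/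
def classBox (R : ℝ) : Finset BondClass :=
  Finset.univ ×ˢ (Finset.univ ×ˢ
    Fintype.piFinset fun _ : Fin 3 => Finset.Icc (-((⌈2 * R⌉₊ : ℤ) + 1)) ((⌈2 * R⌉₊ : ℤ) + 1))

/-- The classes of reference length `‖ζ⁰_c‖ ≤ R` (`ζ⁰ = bondVec 0`): the finite range kept EXACT by a certificate. [folklore] -/
def classesR (R : ℝ) : Finset BondClass :=
  (classBox R).filter fun c => ‖bondVec 0 c‖ ≤ R

/-- The metric-free nearest-neighbour reference form `N₀(w) = Σ_{c ∈ nn} Σ_k ‖Δ_c w k‖²`. [folklore] -/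
def N0 (w : Label → E3) : ℝ := ∑ c ∈ nnClasses, plainForm c w

/-- Far-class longitudinal charge `18·‖ζ⁰_c‖⁻⁸ ≥ sup_window |ω(‖Aζ_c(δ)‖)|·‖ζ_c(δ)‖²` (valid for `‖ζ⁰_c‖ ≥ √2`). [folklore] -/
def farCoeff (c : BondClass) : ℝ := 18 * (‖bondVec 0 c‖⁻¹) ^ 8

/-- The explicit, window-independent, metric-free TAIL FUNCTIONAL beyond range `R`:
`Σ_{‖ζ⁰_c‖ > R} 18‖ζ⁰_c‖⁻⁸ · Σ_k ‖Δ_c w k‖²` (summable for finitely supported `w`). [folklore] -/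
def tailForm (R : ℝ) (w : Label → E3) : ℝ :=
  ∑' c, if c ∈ classesR R then 0 else farCoeff c * plainForm c w

/-- The TRUNCATED-WITH-TAIL form `G_R = Σ_{c ≤ R} classTerm − tailForm R − 2κ·Nform` (finite range + explicit
tail charge; by tail control `Fform κ ≥ G_R`, and `G_R ≥ 0` is what a certificate proves). [folklore] -/
def GR (κ R : ℝ) (A B : E3 →L[ℝ] E3) (δ : E3) (w : Label → E3) : ℝ :=
  (∑ c ∈ classesR R, classTerm A B δ w c) - tailForm R w - 2 * κ * Nform A B δ w

/-- Lattice-sum summability of a label field: `Σ_c ‖ζ⁰_c‖⁻⁸ · Σ_k ‖Δ_c w k‖² < ∞` (holds for every finitely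
supported `w`; it carries the summability of `Hform` and of `tailForm`). [folklore] -/
def LatticeSummable (w : Label → E3) : Prop :=
  Summable fun c : BondClass => (‖bondVec 0 c‖⁻¹) ^ 8 * plainForm c w

/-- The sublattice sign `σ(m) ∈ {0, 1}` as a real number. [folklore] -/
def subSign (m : Fin 2) : ℝ := if m = 1 then 1 else 0


/-! ## The certificate format (transfer target C⁺) -/

/-- A DATA VERTEX: fixed per-class coefficients `(a_c, b_c)` (longitudinal / metric) on the finite range, and a
cell in the weakly-coupled parameters — reference metric `B₀` with operator-norm radius `η`, shift centre `d` with
radius `ρ` (inside the cell the metric and the bond directions are kept EXACT). -/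
structure Vertex where
  /-- longitudinal data `a_c` (to be dominated by `ω(‖Aζ_c(δ)‖)`). -/
  a : BondClass → ℝ
  /-- metric data `b_c` (to be dominated by `ψ(‖Aζ_c(δ)‖)`). -/
  b : BondClass → ℝ
  /-- centre of the metric cell. -/
  B₀ : E3 →L[ℝ] E3
  /-- operator-norm radius of the metric cell. -/
  η : ℝ
  /-- centre of the shift cell. -/
  d : E3
  /-- radius of the shift cell. -/
  ρ : ℝ

/-- The fixed-coefficient reference operator of a vertex (range `R`, stability constant `κ`), evaluated at a metric
`B` and shift `δ` of its cell: `Σ_{c ≤ R} (a_c X_c(δ,w) + b_c Y_c(B,w)) − 2κ Σ_{nn} Y_c(B,w)`. -/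
def PhiR (κ R : ℝ) (v : Vertex) (B : E3 →L[ℝ] E3) (δ : E3) (w : Label → E3) : ℝ :=
  (∑ c ∈ classesR R, (v.a c * longForm δ c w + v.b c * metricForm B c w)) -
    2 * κ * ∑ c ∈ nnClasses, metricForm B c w

/-- COVER (realisability / hugging polytope): every dilation-extreme window point `(A, δ)` with its metric
`B = A⁻ᵀ` lies in the cells of, and its exact data vector `(ω(‖Aζ_c(δ)‖), ψ(‖Aζ_c(δ)‖))_{c ≤ R}` DOMINATES
componentwise, a convex combination of the vertices. -/
def Cover (R : ℝ) {n : ℕ} (V : Fin n → Vertex) : Prop :=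
  ∀ (A B : E3 →L[ℝ] E3) (δ : E3), ExtWindow A δ → Contragredient A B →
    ∃ μ : Fin n → ℝ, (∀ i, 0 ≤ μ i) ∧ ∑ i, μ i = 1 ∧
      (∀ i, μ i ≠ 0 → ‖B - (V i).B₀‖ ≤ (V i).η ∧ ‖δ - (V i).d‖ ≤ (V i).ρ) ∧
      ∀ c ∈ classesR R,
        ∑ i, μ i * (V i).a c ≤ omegaLJ ‖A (bondVec δ c)‖ ∧ ∑ i, μ i * (V i).b c ≤ psiLJ ‖A (bondVec δ c)‖

/-- COERCIVITY of one vertex: its fixed-coefficient operator dominates the tail functional, robustly over its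
metric/shift cell (intersected with the band and the shift ball), on finitely supported `w`. -/
def Coercive (κ R : ℝ) (v : Vertex) : Prop :=
  ∀ (B : E3 →L[ℝ] E3) (δ : E3) (w : Label → E3), MetricBand B → ‖B - v.B₀‖ ≤ v.η → ‖δ - v.d‖ ≤ v.ρ →
    ‖δ‖ ≤ 5 / 189 → (Function.support w).Finite → tailForm R w ≤ PhiR κ R v B δ w

/-- **S5 — the transfer target C⁺ (VERTEX CERTIFICATE):** for some `κ > 0` and range `R ≥ 2`, a FINITE family of
data vertices covers the dilation-extreme sheet and each vertex operator is coercive on its cell. -/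
def VertexCertificate : Prop :=
  ∃ κ : ℝ, 0 < κ ∧ ∃ R : ℝ, 2 ≤ R ∧ ∃ n : ℕ, ∃ V : Fin n → Vertex, Cover R V ∧ ∀ i, Coercive κ R (V i)

/-! ## The six reduction statements -/

/-- **S0 — LATTICE SUM:** for a finitely supported label field the lattice sum `Σ_c ‖ζ⁰_c‖⁻⁸·Σ_k‖Δ_c w k‖²`
converges (pure reference-lattice fact: `Σ_k ‖Δ_c w k‖² ≤ 4·Σ_ℓ‖w ℓ‖²` uniformly in `c`, and `Σ_c ‖ζ⁰_c‖⁻⁸ < ∞`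
over the four shifted copies `latVec ℤ³ + {0, ±innerRef}` of the rank-3 lattice). -/
def LatticeSum : Prop :=
  ∀ w : Label → E3, (Function.support w).Finite → LatticeSummable w

/-- **S1a — LABEL MODEL (geometry of the pull-back):** an admissible datum `(t, A)` has a contragredient
`B = A⁻ᵀ` and a pulled-back shift error `δ = A⁻¹(t 1 − t 0) − innerRef` in the window, and the label map
`ℓ ↦ t 0 + A·refPos δ ℓ` is a bijection `Label → Sites₀ t A` (`A` injective on the window; distinct sublattices
cannot collide because `dist(innerRef, Λ₀) = 1 > 5/189 ≥ ‖δ‖`). -/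
def LabelModel : Prop :=
  ∀ (t : Fin 2 → E3) (A : E3 →L[ℝ] E3), Adm₀ A → Inner₀ t A →
    ∃ (B : E3 →L[ℝ] E3) (δ : E3), CellWindow A ∧ ShiftWindow A δ ∧ Contragredient A B ∧
      Function.Injective (siteMap t A δ) ∧ Set.range (siteMap t A δ) = Sites₀ t A

/-- **S1b — PULL-BACK REDUCTION (analysis of the pull-back):** given the label bijection, every finitely supported
displacement `u` of the site set is `u ∘ site = B ∘ w` for a finitely supported label field `w` (take
`w = Aᵀ ∘ u ∘ site`), and — granted the lattice sum for `w` — the class family is summable and the typed double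
`tsum`s equal the class-indexed forms: `nnForm t A u = Nform A B δ w`, `hessForm t A u = Hform A B δ w`
(re-indexing `Sites × Sites ≃ Label × Label ≃ BondClass × ℤ³` by absolute summability, `|Hess₀ e v| ≤ 904‖e‖⁻⁸‖v‖²`,
and the per-bond identity `Hess₀(Aζ)(BΔ) = ω(‖Aζ‖)⟪ζ,Δ⟫² + ψ(‖Aζ‖)‖BΔ‖²`). -/
def PullbackReduction : Prop :=
  ∀ (t : Fin 2 → E3) (A B : E3 →L[ℝ] E3) (δ : E3), CellWindow A → ShiftWindow A δ → Contragredient A B →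
    Function.Injective (siteMap t A δ) → Set.range (siteMap t A δ) = Sites₀ t A →
    ∀ u : E3 → E3, (Function.support u).Finite → Function.support u ⊆ Sites₀ t A →
      ∃ w : Label → E3, (Function.support w).Finite ∧
        (LatticeSummable w → Summable (classTerm A B δ w) ∧
          nnForm t A u = Nform A B δ w ∧ hessForm t A u = Hform A B δ w)

/-- **S2 — WINDOW GEOMETRY (bond graph and lengths):** on the window the metric bond graph IS the reference
nearest-neighbour graph (`‖Aζ_c(δ)‖ ≤ 11/10 ⟺ c ∈ nnClasses` for `c` non-diagonal), nearest-neighbour lengths lie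
in `[23/25, 511/500]` (in-plane ones in `[189/200, 199/200]`), and all other lengths are `≥ 131/100` (nearest non-NN
reference length `√2`, shift `‖δ‖ ≤ 5/189`, stretch `≥ 0.945`). -/
def WindowGeometry : Prop :=
  ∀ (A : E3 →L[ℝ] E3) (δ : E3), CellWindow A → ShiftWindow A δ →
    (∀ c : BondClass, ¬ diagClass c → (c ∈ nnClasses ↔ ‖A (bondVec δ c)‖ ≤ 11 / 10)) ∧
      (∀ c ∈ nnClasses, 23 / 25 ≤ ‖A (bondVec δ c)‖ ∧ ‖A (bondVec δ c)‖ ≤ 511 / 500) ∧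
      (∀ c ∈ nnClasses, c.1 = c.2.1 → 189 / 200 ≤ ‖A (bondVec δ c)‖ ∧ ‖A (bondVec δ c)‖ ≤ 199 / 200) ∧
      (∀ c : BondClass, ¬ diagClass c → c ∉ nnClasses → 131 / 100 ≤ ‖A (bondVec δ c)‖)

/-- **S3 — TAIL CONTROL (one-sided far field, `tsum` form):** beyond range `R ≥ 2` the far part of the class
family is bounded BELOW by minus the explicit tail functional, uniformly on the window (classes outside
`classesR R` have `‖ζ⁰‖ > R`, hence actual length `≥ 0.945(R − 5/189) > 1.86`: drop `ψ > 0`, bound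
`|ω(r)|‖ζ(δ)‖² ≤ 18‖ζ⁰‖⁻⁸`; both `tsum`s are summable by the two summability hypotheses). -/
def TailControl : Prop :=
  ∀ R : ℝ, 2 ≤ R → ∀ (A B : E3 →L[ℝ] E3) (δ : E3) (w : Label → E3),
    CellWindow A → ShiftWindow A δ → (Function.support w).Finite → LatticeSummable w →
      Summable (classTerm A B δ w) →
        -tailForm R w ≤ ∑' c, if c ∈ classesR R then 0 else classTerm A B δ w c

/-- **S4 — DILATION REDUCTION ((12,6) bi-homogeneity) on the truncated-with-tail form:** along `s ↦ (sA, s⁻¹B)`,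
`s¹⁰·GR κ R (sA) (s⁻¹B) δ w = σ·P + Q − σ^{-5/3}·tailForm − 2κσ^{-4/3}·N` with `σ = s⁻⁶`
(`s¹⁰ω(sr) = 14σr⁻¹⁶ − 8r⁻¹⁰`, `s⁸ψ(sr) = −σr⁻¹⁴ + r⁻⁸`, `N = Σ_{nn} Y_c(B,w)` by bond-graph constancy on the
admissible dilation interval — this is where `WindowGeometry` is used), a CONCAVE function of `σ`; hence the
value at `σ = 1` dominates the value at one of the two dilation-extreme endpoints
(`s₀ = 0.945/σ_min(A)`, `s₁ = min(0.995/σ_max(A), (1/40)/‖Aδ‖)`, which exist by compactness of the unit sphere). -/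
def DilationReduction : Prop :=
  WindowGeometry → ∀ κ : ℝ, 0 ≤ κ → ∀ (R : ℝ) (A B : E3 →L[ℝ] E3) (δ : E3) (w : Label → E3),
    CellWindow A → ShiftWindow A δ →
      ∃ s : ℝ, 0 < s ∧ ExtWindow (s • A) δ ∧ s ^ 10 * GR κ R (s • A) (s⁻¹ • B) δ w ≤ GR κ R A B δ w

/-! ## Anchor -/

/-- Registered anchor sub-goal of the line (`stub_defs`): units sanity of the pulled-back coefficients at the LJ
equilibrium bond `r = 1` (`ω(1) = V″(1) = 6`, `ψ(1) = V′(1) = 0`); its landing puts this vocabulary in the tree. [folklore] -/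
theorem stub_defs : omegaLJ 1 = 6 ∧ psiLJ 1 = 0 := by norm_num [omegaLJ, psiLJ]

end Summit.AtomisticToContinuum.Crystallization.Theorems.PhononStabilityCWC

end
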